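import Summits.ResolutionOfSingularities.ResolutionOfSingularities.Theorems.EquisingularLiftEquisingularLiftNatSubmaxLineShape
import Mathlib.RingTheory.MvPolynomial.EulerIdentity
import HarnessLib

/-!
# [OURS] SINGULAR POINTS OF CUBIC SURFACES — the coefficient algebra of a cubic form singular at coordinate vertices
# (cruxes `EquisingularLiftNatThree` stmt-…-20148, `EquisingularLiftNat` stmt-…-20038, `EquisingularLift` stmt-…-15660)

[OURS · leafhand-res-equisingularlift-8 g0, 2026-08-31; cell `pub/decomp-res`] AI-produced, weaker than expert review; NOT a statement of any manuscript;
nothing here proves resolution of singularities in positive characteristic.  DEF-FREE helper; no `sorry`; standard axioms; ZERO named hypotheses.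

The classical fact «an irreducible cubic surface that is not singular along a line has at most four singular points, and they are in linearly general
position» (Cayley–Salmon–Schläfli; e.g. Bruce–Wall, *On the classification of cubic surfaces*, J. LMS 19 (1979) §1), in EVERY characteristic, reduced
to coefficient bookkeeping for a cubic form `F ∈ K[x₀,…,x₃]` singular at coordinate vertices («singular at `b`» = `F(b) = 0 ∧ ∇F(b) = 0`):

* `apply_le_one_of_singular_vertex` — `F` singular at the vertex `e_c` ⟹ every monomial of `F` has `x_c`-degree `≤ 1`;
* `mem_sq_of_singular_collinear` — singular at `e₀, e₁, e₀ + e₁` (three collinear points) ⟹ `F ∈ (x₂, x₃)²` (the whole line is singular: the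
  «submaximal line» family of ✓ `SubmaxLine.exists_shape_of_mem_pow`);
* `X_dvd_of_singular_coplanar` — singular at `e₀, e₁, e₂, e₀ + e₁ + e₂` (four coplanar points, no three collinear) ⟹ `x₃ ∣ F` (`F` is reducible);
* `eq_zero_of_singular_five` — singular at `e₀, …, e₃` and `e₀ + e₁ + e₂ + e₃` (five points, no four coplanar) ⟹ `F = 0`;
* (the same after an arbitrary linear change of coordinates `x ↦ Bx`: companion file `…CubicSurfaceSingularPointsTransport`).

References: [Hartshorne1977, I Ex. 5.8 (singular points of hypersurfaces)]; Bruce–Wall 1979 §1 (statement only; the proofs here are elementary).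
-/

set_option linter.dupNamespace false -- mandated namespace `Summit.<Summit>.<Problem>` of this single-conjunct summit

noncomputable section

open MvPolynomial

namespace Summit.ResolutionOfSingularities.ResolutionOfSingularities.Cruxes.EquisingularLiftNat.Sections

namespace CubicNodes

variable {K : Type} [Field K]

/-! ## Bookkeeping on exponents -/

/-- The four entries of an exponent of a form of degree `d` on `Fin 4` sum to `d`. [folklore] -/
theorem sum_eq_of_mem_support {F : MvPolynomial (Fin 4) K} {d : ℕ} (hF : F.IsHomogeneous d)
    {m : Fin 4 →₀ ℕ} (hm : m ∈ F.support) : m 0 + m 1 + m 2 + m 3 = d := by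
  rw [← SubmaxLine.sum_support_eq, ← hF.degree_eq_sum_deg_support hm]

/-- The degree of an exponent of a form of degree `d` is `d`. [folklore] -/
theorem degree_eq_of_mem_support {N : ℕ} {F : MvPolynomial (Fin N) K} {d : ℕ} (hF : F.IsHomogeneous d)
    {m : Fin N →₀ ℕ} (hm : m ∈ F.support) : m.degree = d := by
  rw [Finsupp.degree_apply]; exact (hF.degree_eq_sum_deg_support hm).symm

/-- Two exponents on `Fin 4` with the same four entries are equal. [folklore] -/
theorem finsupp_eq_of_apply_eq {m m' : Fin 4 →₀ ℕ} (h0 : m 0 = m' 0) (h1 : m 1 = m' 1) (h2 : m 2 = m' 2) (h3 : m 3 = m' 3) :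
    m = m' := by
  ext i
  fin_cases i
  exacts [h0, h1, h2, h3]

/-- An exponent supported in `{c}` is `(m c)·e_c`. [folklore] -/
theorem eq_single_of_forall_ne {N : ℕ} {m : Fin N →₀ ℕ} (c : Fin N) (h : ∀ i, i ≠ c → m i = 0) :
    m = Finsupp.single c (m c) := by
  classical
  refine Finsupp.eq_single_iff.mpr ⟨fun i hi => ?_, rfl⟩
  rw [Finset.mem_singleton]
  by_contra hic
  exact (Finsupp.mem_support_iff.mp hi) (h i hic)

/-- **Evaluation of a partial derivative as a sum over the support**:
`(∂ⱼF)(x) = Σ_{m ∈ supp F} coeff_m F · m_j · x^{m − e_j}`. [folklore] -/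
theorem eval_pderiv_eq_sum {N : ℕ} (x : Fin N → K) (j : Fin N) (F : MvPolynomial (Fin N) K) :
    eval x (pderiv j F) = ∑ m ∈ F.support, coeff m F * (m j : K) * ∏ i, x i ^ (m - Finsupp.single j 1 : Fin N →₀ ℕ) i := by
  conv_lhs => rw [F.as_sum, map_sum, map_sum]
  refine Finset.sum_congr rfl fun m _ => ?_
  rw [pderiv_monomial, eval_monomial, Finsupp.prod_pow]

/-- **Evaluation as a sum over the support**: `F(x) = Σ_{m ∈ supp F} coeff_m F · x^m`. [folklore] -/
theorem eval_eq_sum {N : ℕ} (x : Fin N → K) (F : MvPolynomial (Fin N) K) :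
    eval x F = ∑ m ∈ F.support, coeff m F * ∏ i, x i ^ m i :=
  eval_eq' x F

/-! ## A cubic form singular at a coordinate vertex -/

/-- `F(e_c)` is the coefficient of `x_c³` (for a cubic form `F`). [folklore] -/
theorem eval_single_eq_coeff {F : MvPolynomial (Fin 4) K} (hF : F.IsHomogeneous 3) (c : Fin 4) :
    eval (Pi.single c 1 : Fin 4 → K) F = coeff (Finsupp.single c 3) F := by
  classical
  rw [eval_eq_sum]
  have hmain : ∏ i : Fin 4, (Pi.single c 1 : Fin 4 → K) i ^ (Finsupp.single c 3 : Fin 4 →₀ ℕ) i = 1 := by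
    refine Finset.prod_eq_one fun i _ => ?_
    by_cases hi : i = c
    · subst hi; simp
    · rw [Pi.single_eq_of_ne hi, Finsupp.single_eq_of_ne hi, pow_zero]
  rw [Finset.sum_eq_single (Finsupp.single c 3)]
  · rw [hmain, mul_one]
  · intro m hm hne
    -- some other variable occurs in `m`
    have hex : ∃ i, i ≠ c ∧ m i ≠ 0 := by
      by_contra h
      push Not at h
      apply hne
      have h1 := eq_single_of_forall_ne c h
      have h2 := degree_eq_of_mem_support hF hm
      rw [h1, Finsupp.degree_single] at h2
      rw [h1, h2]
    obtain ⟨i, hic, hi⟩ := hex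
    rw [Finset.prod_eq_zero (Finset.mem_univ i) (by rw [Pi.single_eq_of_ne hic, zero_pow hi]), mul_zero]
  · intro h
    rw [notMem_support_iff.mp h, zero_mul]

/-- `(∂ⱼF)(e_c)` (`j ≠ c`) is the coefficient of `x_c² x_j` (for a cubic form `F`). [folklore] -/
theorem eval_single_pderiv_eq_coeff {F : MvPolynomial (Fin 4) K} (hF : F.IsHomogeneous 3) (c j : Fin 4) (hjc : j ≠ c) :
    eval (Pi.single c 1 : Fin 4 → K) (pderiv j F) = coeff (Finsupp.single c 2 + Finsupp.single j 1) F := by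
  classical
  rw [eval_pderiv_eq_sum]
  set m₀ : Fin 4 →₀ ℕ := Finsupp.single c 2 + Finsupp.single j 1 with hm₀
  have hm₀j : m₀ j = 1 := by
    simp [hm₀, Ne.symm hjc]
  have hm₀sub : m₀ - Finsupp.single j 1 = Finsupp.single c 2 := by
    rw [hm₀, add_tsub_cancel_right]
  have hmain : ∏ i : Fin 4, (Pi.single c 1 : Fin 4 → K) i ^ (Finsupp.single c 2 : Fin 4 →₀ ℕ) i = 1 := by
    refine Finset.prod_eq_one fun i _ => ?_
    by_cases hi : i = c
    · subst hi; simp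
    · rw [Pi.single_eq_of_ne hi, Finsupp.single_eq_of_ne hi, pow_zero]
  rw [Finset.sum_eq_single m₀]
  · rw [hm₀j, hm₀sub, hmain, Nat.cast_one, mul_one, mul_one]
  · intro m hm hne
    by_cases hmj : m j = 0
    · rw [hmj, Nat.cast_zero, mul_zero, zero_mul]
    -- some variable other than `x_c` survives in `m - e_j`
    have hex : ∃ i, i ≠ c ∧ (m - Finsupp.single j 1 : Fin 4 →₀ ℕ) i ≠ 0 := by
      by_contra h
      push Not at h
      apply hne
      have hle : Finsupp.single j 1 ≤ m := Finsupp.single_le_iff.mpr (Nat.one_le_iff_ne_zero.mpr hmj)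
      have h1 := eq_single_of_forall_ne c h
      have h2 := degree_eq_of_mem_support hF hm
      have h3 : m = (m - Finsupp.single j 1) + Finsupp.single j 1 := (tsub_add_cancel_of_le hle).symm
      rw [h3, map_add, h1, Finsupp.degree_single, Finsupp.degree_single] at h2
      have hc2 : (m - Finsupp.single j 1 : Fin 4 →₀ ℕ) c = 2 := by omega
      rw [h3, h1, hc2, hm₀]
    obtain ⟨i, hic, hi⟩ := hex
    rw [Finset.prod_eq_zero (Finset.mem_univ i) (by rw [Pi.single_eq_of_ne hic, zero_pow hi]), mul_zero]
  · intro h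
    rw [notMem_support_iff.mp h, zero_mul, zero_mul]

/-- ★ **A cubic form singular at the vertex `e_c` has `x_c`-degree `≤ 1` in every monomial**: `F(e_c) = 0` kills `x_c³` and `∇F(e_c) = 0` kills the
`x_c² x_j`. [cite: Hartshorne1977, I Ex. 5.8] -/
theorem apply_le_one_of_singular_vertex {F : MvPolynomial (Fin 4) K} (hF : F.IsHomogeneous 3) (c : Fin 4)
    (h0 : eval (Pi.single c 1 : Fin 4 → K) F = 0) (hd : ∀ j, eval (Pi.single c 1 : Fin 4 → K) (pderiv j F) = 0) :
    ∀ m ∈ F.support, m c ≤ 1 := by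
  classical
  intro m hm
  by_contra hlt
  push Not at hlt
  have hc3 : coeff (Finsupp.single c 3) F = 0 := by rw [← eval_single_eq_coeff hF c]; exact h0
  have hc2 : ∀ j, j ≠ c → coeff (Finsupp.single c 2 + Finsupp.single j 1) F = 0 := fun j hjc => by
    rw [← eval_single_pderiv_eq_coeff hF c j hjc]; exact hd j
  have hne : coeff m F ≠ 0 := mem_support_iff.mp hm
  -- `m = 2 e_c + e_j` for some `j` (possibly `j = c`)
  have hle : Finsupp.single c 2 ≤ m := Finsupp.single_le_iff.mpr hlt
  have hmr : m = Finsupp.single c 2 + (m - Finsupp.single c 2) := (add_tsub_cancel_of_le hle).symm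
  have hrdeg : (m - Finsupp.single c 2).degree = 1 := by
    have h := degree_eq_of_mem_support hF hm
    rw [hmr, map_add, Finsupp.degree_single] at h
    omega
  obtain ⟨j, hj⟩ := (Finsupp.sum_eq_one_iff (m - Finsupp.single c 2)).mp
    (by rw [← hrdeg, Finsupp.degree_apply]; rfl)
  rw [hj] at hmr
  by_cases hjc : j = c
  · rw [hjc, ← Finsupp.single_add] at hmr
    exact hne (hmr ▸ hc3)
  · exact hne (hmr ▸ hc2 j hjc)

/-! ## Three collinear, four coplanar, five general singular points -/

/-- The product `x^m'` at the point `(1,1,0,0)` is `1` if `m'₂ = m'₃ = 0` and `0` otherwise. [folklore] -/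
theorem prod_oneOneZeroZero (m' : Fin 4 →₀ ℕ) :
    ∏ i : Fin 4, (![1, 1, 0, 0] : Fin 4 → K) i ^ m' i = if m' 2 = 0 ∧ m' 3 = 0 then 1 else 0 := by
  rw [Fin.prod_univ_four]
  simp only [Matrix.cons_val_zero, Matrix.cons_val_one, Matrix.cons_val, one_pow, one_mul]
  by_cases h2 : m' 2 = 0
  · by_cases h3 : m' 3 = 0
    · simp [h2, h3]
    · simp [h2, h3, zero_pow h3]
  · simp [h2, zero_pow h2]

/-- ★ **Three collinear singular points.**  A cubic form `F` singular at the vertices `e₀, e₁` (so of `x₀`- and `x₁`-degree `≤ 1`) with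
`∂₂F(e₀ + e₁) = ∂₃F(e₀ + e₁) = 0` lies in `(x₂, x₃)²`: the line `V(x₂, x₃)` is a line of multiplicity `2 = deg F − 1`.  (Binary cubic with two double
roots vanishes; binary quadric with three roots vanishes.) [cite: Hartshorne1977, I Ex. 5.8] -/
theorem mem_sq_of_singular_collinear {F : MvPolynomial (Fin 4) K} (hF : F.IsHomogeneous 3)
    (hv0 : ∀ m ∈ F.support, m 0 ≤ 1) (hv1 : ∀ m ∈ F.support, m 1 ≤ 1)
    (hd2 : eval (![1, 1, 0, 0] : Fin 4 → K) (pderiv 2 F) = 0) (hd3 : eval (![1, 1, 0, 0] : Fin 4 → K) (pderiv 3 F) = 0) :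
    F ∈ (Ideal.span {(X 2 : MvPolynomial (Fin 4) K), X 3}) ^ 2 := by
  classical
  -- the coefficients of `x₀x₁x₂` and `x₀x₁x₃` vanish
  have hkill : ∀ (j : Fin 4) (m₀ : Fin 4 →₀ ℕ), m₀ 0 = 1 → m₀ 1 = 1 → m₀ j = 1 → m₀ 2 + m₀ 3 = 1 → (j = 2 ∨ j = 3) →
      eval (![1, 1, 0, 0] : Fin 4 → K) (pderiv j F) = 0 → coeff m₀ F = 0 := by
    intro j m₀ hm0 hm1 hmj hm23 hj hev
    rw [eval_pderiv_eq_sum, Finset.sum_eq_single m₀] at hev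
    · have hp : ∏ i : Fin 4, (![1, 1, 0, 0] : Fin 4 → K) i ^ (m₀ - Finsupp.single j 1 : Fin 4 →₀ ℕ) i = 1 := by
        rw [prod_oneOneZeroZero, if_pos]
        simp only [Finsupp.coe_tsub, Pi.sub_apply, Finsupp.single_apply]
        rcases hj with rfl | rfl <;> simp <;> omega
      rwa [hp, hmj, Nat.cast_one, mul_one, mul_one] at hev
    · intro m hm hne
      by_cases hmj' : m j = 0
      · rw [hmj', Nat.cast_zero, mul_zero, zero_mul]
      rw [prod_oneOneZeroZero]
      split_ifs with h
      · exfalso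
        apply hne
        have hdeg := sum_eq_of_mem_support hF hm
        have h0 := hv0 m hm
        have h1 := hv1 m hm
        simp only [Finsupp.coe_tsub, Pi.sub_apply, Finsupp.single_apply] at h
        rcases hj with rfl | rfl <;> simp at h hmj' <;> apply finsupp_eq_of_apply_eq <;> omega
      · rw [mul_zero]
    · intro h
      rw [notMem_support_iff.mp h, zero_mul, zero_mul]
  -- every monomial has `x₂x₃`-degree `≥ 2`
  have hsupp : ∀ m ∈ F.support, 2 ≤ m 2 + m 3 := by
    intro m hm
    by_contra hlt
    push Not at hlt
    have hdeg := sum_eq_of_mem_support hF hm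
    have h0 := hv0 m hm
    have h1 := hv1 m hm
    have hne : coeff m F ≠ 0 := mem_support_iff.mp hm
    rcases Nat.eq_zero_or_pos (m 2) with h2 | h2
    · exact hne (hkill 3 m (by omega) (by omega) (by omega) (by omega) (Or.inr rfl) hd3)
    · exact hne (hkill 2 m (by omega) (by omega) (by omega) (by omega) (Or.inl rfl) hd2)
  -- hence `F ∈ (x₂, x₃)²`, monomial by monomial
  set I : Ideal (MvPolynomial (Fin 4) K) := Ideal.span {(X 2 : MvPolynomial (Fin 4) K), X 3} with hI
  have hX2 : (X 2 : MvPolynomial (Fin 4) K) ∈ I := Ideal.subset_span (by simp)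
  have hX3 : (X 3 : MvPolynomial (Fin 4) K) ∈ I := Ideal.subset_span (by simp)
  rw [F.as_sum]
  refine Ideal.sum_mem _ fun m hm => ?_
  have hmon : monomial m (coeff m F) = C (coeff m F) * X 0 ^ m 0 * X 1 ^ m 1 * (X 2 ^ m 2 * X 3 ^ m 3) := by
    rw [monomial_eq, Finsupp.prod_pow, Fin.prod_univ_four]; ring
  rw [hmon]
  refine Ideal.mul_mem_left _ _ ?_
  have h23 : (X 2 : MvPolynomial (Fin 4) K) ^ m 2 * X 3 ^ m 3 ∈ I ^ (m 2 + m 3) := by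
    rw [pow_add]
    exact Ideal.mul_mem_mul (Ideal.pow_mem_pow hX2 _) (Ideal.pow_mem_pow hX3 _)
  exact Ideal.pow_le_pow_right (hsupp m hm) h23

/-- The product `x^m'` at the point `(1,1,1,0)` is `1` if `m'₃ = 0` and `0` otherwise. [folklore] -/
theorem prod_oneOneOneZero (m' : Fin 4 →₀ ℕ) :
    ∏ i : Fin 4, (![1, 1, 1, 0] : Fin 4 → K) i ^ m' i = if m' 3 = 0 then 1 else 0 := by
  rw [Fin.prod_univ_four]
  simp only [Matrix.cons_val_zero, Matrix.cons_val_one, Matrix.cons_val, one_pow, one_mul]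
  by_cases h3 : m' 3 = 0
  · simp [h3]
  · simp [h3, zero_pow h3]

/-- ★ **Four coplanar singular points, no three collinear.**  A cubic form `F` singular at the vertices `e₀, e₁, e₂` (so of `x₀`-, `x₁`-, `x₂`-degree
`≤ 1`) with `∂₀F(e₀ + e₁ + e₂) = 0` is divisible by `x₃`: the plane `V(x₃)` is a component.  (The plane cubic through the four points contains the
six lines joining them.) [cite: Hartshorne1977, I Ex. 5.8] -/
theorem X_dvd_of_singular_coplanar {F : MvPolynomial (Fin 4) K} (hF : F.IsHomogeneous 3)
    (hv0 : ∀ m ∈ F.support, m 0 ≤ 1) (hv1 : ∀ m ∈ F.support, m 1 ≤ 1) (hv2 : ∀ m ∈ F.support, m 2 ≤ 1)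
    (hd0 : eval (![1, 1, 1, 0] : Fin 4 → K) (pderiv 0 F) = 0) :
    (X 3 : MvPolynomial (Fin 4) K) ∣ F := by
  classical
  -- the coefficient of `x₀x₁x₂` vanishes
  set m₀ : Fin 4 →₀ ℕ := Finsupp.single 0 1 + Finsupp.single 1 1 + Finsupp.single 2 1 with hm₀
  have hm₀v : m₀ 0 = 1 ∧ m₀ 1 = 1 ∧ m₀ 2 = 1 ∧ m₀ 3 = 0 := by
    simp [hm₀]
  have hcoeff : coeff m₀ F = 0 := by
    rw [eval_pderiv_eq_sum, Finset.sum_eq_single m₀] at hd0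
    · have hp : ∏ i : Fin 4, (![1, 1, 1, 0] : Fin 4 → K) i ^ (m₀ - Finsupp.single 0 1 : Fin 4 →₀ ℕ) i = 1 := by
        rw [prod_oneOneOneZero, if_pos]
        simp only [Finsupp.coe_tsub, Pi.sub_apply, Finsupp.single_apply]
        simp [hm₀v.2.2.2]
      rwa [hp, hm₀v.1, Nat.cast_one, mul_one, mul_one] at hd0
    · intro m hm hne
      by_cases hmj' : m 0 = 0
      · rw [hmj', Nat.cast_zero, mul_zero, zero_mul]
      rw [prod_oneOneOneZero]
      split_ifs with h
      · exfalso
        apply hne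
        have hdeg := sum_eq_of_mem_support hF hm
        have h0 := hv0 m hm
        have h1 := hv1 m hm
        have h2 := hv2 m hm
        simp only [Finsupp.coe_tsub, Pi.sub_apply, Finsupp.single_apply] at h
        simp at h
        apply finsupp_eq_of_apply_eq <;> omega
      · rw [mul_zero]
    · intro h
      rw [notMem_support_iff.mp h, zero_mul, zero_mul]
  -- every monomial involves `x₃`
  have hsupp : ∀ m ∈ F.support, m 3 ≠ 0 := by
    intro m hm h3
    have hdeg := sum_eq_of_mem_support hF hm
    have h0 := hv0 m hm
    have h1 := hv1 m hm
    have h2 := hv2 m hm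
    have hm' : m = m₀ := by apply finsupp_eq_of_apply_eq <;> omega
    exact (mem_support_iff.mp hm) (hm' ▸ hcoeff)
  have hmem : F ∈ Ideal.span (MvPolynomial.X '' ({3} : Set (Fin 4)) : Set (MvPolynomial (Fin 4) K)) :=
    mem_ideal_span_X_image.mpr fun m hm => ⟨3, rfl, hsupp m hm⟩
  rw [Set.image_singleton] at hmem
  exact Ideal.mem_span_singleton.mp hmem

/-- ★ **Five singular points, no four coplanar.**  A cubic form `F` singular at all four vertices (so multilinear) and at `e₀ + e₁ + e₂ + e₃`
vanishes: `F = a·x₁x₂x₃ + b·x₀x₂x₃ + c·x₀x₁x₃ + d·x₀x₁x₂` and `F(1,1,1,1) − ∂ⱼF(1,1,1,1)` is the coefficient of the monomial omitting `x_j`.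
[cite: Hartshorne1977, I Ex. 5.8] -/
theorem eq_zero_of_singular_five {F : MvPolynomial (Fin 4) K} (hF : F.IsHomogeneous 3)
    (hv : ∀ c : Fin 4, ∀ m ∈ F.support, m c ≤ 1)
    (h1 : eval (fun _ => (1 : K)) F = 0) (hd1 : ∀ j, eval (fun _ => (1 : K)) (pderiv j F) = 0) : F = 0 := by
  classical
  by_contra hF0
  obtain ⟨m₀, hm₀⟩ := Finset.nonempty_of_ne_empty (mt MvPolynomial.support_eq_empty.mp hF0)  -- a monomial of `F`
  have hdeg₀ := sum_eq_of_mem_support hF hm₀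
  have hb₀ := fun c => hv c m₀ hm₀
  -- the omitted variable `x_j` of `m₀`
  have hex : ∃ j : Fin 4, m₀ j = 0 := by
    have := hb₀ 0; have := hb₀ 1; have := hb₀ 2; have := hb₀ 3
    by_contra h
    push Not at h
    have := h 0; have := h 1; have := h 2; have := h 3
    omega
  obtain ⟨j, hj⟩ := hex
  -- `F(𝟙) - ∂ⱼF(𝟙) = Σ_m coeff_m F · (1 - m_j) = coeff_{m₀} F`
  have hsum : ∑ m ∈ F.support, coeff m F * (1 - (m j : K)) = 0 := by
    have e1 : eval (fun _ => (1 : K)) F = ∑ m ∈ F.support, coeff m F := by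
      rw [eval_eq_sum]; exact Finset.sum_congr rfl fun m _ => by simp
    have e2 : eval (fun _ => (1 : K)) (pderiv j F) = ∑ m ∈ F.support, coeff m F * (m j : K) := by
      rw [eval_pderiv_eq_sum]; exact Finset.sum_congr rfl fun m _ => by simp
    have h := congrArg₂ (· - ·) e1 e2
    simp only [h1, hd1 j, sub_zero] at h
    rw [← Finset.sum_sub_distrib] at h
    rw [h]
    exact Finset.sum_congr rfl fun m _ => by ring
  rw [Finset.sum_eq_single_of_mem m₀ hm₀] at hsum
  · rw [hj, Nat.cast_zero, sub_zero, mul_one] at hsum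
    exact (mem_support_iff.mp hm₀) hsum
  · intro m hm hne
    have hdeg := sum_eq_of_mem_support hF hm
    have hb := fun c => hv c m hm
    have hb0 := hb 0; have hb1 := hb 1; have hb2 := hb 2; have hb3 := hb 3
    have hb₀0 := hb₀ 0; have hb₀1 := hb₀ 1; have hb₀2 := hb₀ 2; have hb₀3 := hb₀ 3
    by_cases hmj : m j = 1
    · rw [hmj, Nat.cast_one, sub_self, mul_zero]
    · exfalso
      apply hne
      fin_cases j <;> simp at hj hmj ⊢ <;> apply finsupp_eq_of_apply_eq <;> omega

end CubicNodes

end Summit.ResolutionOfSingularities.ResolutionOfSingularities.Cruxes.EquisingularLiftNat.Sections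

end
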